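import Literature.NumberTheory.ModularForms.BinaryQuadGaussSumGenusPhase
import HarnessLib

/-!
# Gauss sums of binary quadratic forms, IX: the phase at a CUSP `a/c` of a form of discriminant
# `−q` (`q` squarefree odd) — `G(a, c; f, 0) = ((a·A)/s)·E(c, q)`, `s = (c, q)`, `|E(c, q)| = c√s`

Topic `NumberTheory/ModularForms` (namespace `Literature.NumberTheory.ModularForms`): the
specialisation of `BinaryQuadGaussSumGenusPhase.lean` to the setting of the class-group theta
series of `K = ℚ(√−q)` (Conrey–Iwaniec §§2–3): `f` a form of discriminant `−q`, `q` squarefree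
and odd, an ARBITRARY modulus `c = 2^k·(s·c₁)` with `s = (c, q)` and `c₁` odd (so `2^k ∥ c`).
Everything here is PROVED (theorems only; no definition, no named fact).

* `cusp_phase_data` — the bookkeeping: `s` is odd, `−q = s·(−(q/s))` and `(−(q/s), c₁) = 1`
  (from `(c, q) = s`), i.e. the hypotheses of `binQuadGaussSum_zero_zero_eq_phase`.
* `binQuadGaussSum_zero_zero_eq_phase_cusp` — **`G(a, c; f, 0) = ((a·g.a)/s) · E(c, q)`** for any
  `g` properly equivalent to `f` with `(g.a, c) = 1` and any `(a, c) = 1`, where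
  `E(c, q) = χ₈(−q)^k · 2^k · (2^k/s) · ((q/s)/c₁) · G(1; s·c₁) · s · G(1; c₁)` depends only on
  `c` and `q` (through `k, s, c₁`): the numerator enters through `χ_s(a)`, the class of `f` through
  `χ_s(g.a) = ψ_s([f])` — the factorisation `η = χ_s(a)·η₀·ψ_s` of the pseudo-eigenvalue of the
  theta series at the cusp `a/c` (Conrey–Iwaniec (2.31), (3.15), (3.17)), form by form.
* `norm_cusp_phaseFactor` — **`|E(c, q)| = c·√s`** (so `η = −i·G/(c√s)` has `|η| = 1`).

## References

* B. Conrey, H. Iwaniec, Acta Arith. 103 (2002) 259–312, §2 (2.15), (2.30)–(2.31); §3 (3.15),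
  (3.17)–(3.18) [ConreyIwaniec2002].
* A. N. Andrianov, V. G. Zhuravlev, *Modular Forms and Hecke Operators*, AMS (1995/2015), Ch. 1
  §4.4 Proposition 4.9, §4.5 Lemmas 4.13–4.14 [AndrianovZhuravlev2015].
-/

noncomputable section

open Complex Finset

namespace Literature.NumberTheory.ModularForms

open Literature.NumberTheory.EllipticCurves.ModularForms
open Literature.NumberTheory.QuadraticFields.Quadratic (BinQF)

open scoped NumberTheorySymbols

/-- **Cusp bookkeeping.** For `q` odd, `c = 2^k·(s·c₁) ≥ 1` with `s = (c, q)`: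
`s` is odd, `−q = s·(−(q/s))`, and `(−(q/s), c₁) = 1` (as `(c/s, q/s) = 1` and `c₁ ∣ c/s`) — the
hypotheses of `binQuadGaussSum_zero_zero_eq_phase` in the cusp setting `s = (c,q)`, `r = q/s` of
Conrey–Iwaniec (3.16)–(3.17). [cite: ConreyIwaniec2002, §3 (3.16)–(3.17)] -/
theorem cusp_phase_data {q : ℕ} (hqodd : Odd q) {k s c₁ c : ℕ} [NeZero c]
    (hc : c = 2 ^ k * (s * c₁)) (hs : s = c.gcd q) :
    Odd s ∧ (-(q : ℤ)) = (s : ℤ) * (-((q / s : ℕ) : ℤ)) ∧ (-((q / s : ℕ) : ℤ)).gcd c₁ = 1 := by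
  have hsq : s ∣ q := hs ▸ Nat.gcd_dvd_right c q
  have hsc : s ∣ c := hs ▸ Nat.gcd_dvd_left c q
  have hs0 : 0 < s := Nat.pos_of_ne_zero fun h ↦ by
    rw [h] at hsc; exact NeZero.ne c (Nat.eq_zero_of_zero_dvd hsc)
  refine ⟨hqodd.of_dvd_nat hsq, ?_, ?_⟩
  · rw [mul_neg, ← Nat.cast_mul, Nat.mul_div_cancel' hsq]
  · have hcop : Nat.Coprime (c / s) (q / s) := by
      rw [hs]; exact Nat.coprime_div_gcd_div_gcd (hs ▸ hs0)
    have hc₁ : c₁ ∣ c / s := ⟨2 ^ k, by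
      rw [hc, show 2 ^ k * (s * c₁) = s * (2 ^ k * c₁) by ring, Nat.mul_div_cancel_left _ hs0]
      ring⟩
    have h1 : Nat.Coprime (q / s) c₁ := hcop.symm.coprime_dvd_right hc₁
    rw [Int.neg_gcd, Int.gcd_natCast_natCast]
    exact h1

/-- **The phase at a cusp.** Let `q` be odd (squarefree in the application), `f` a form of discriminant `−q`,
`g` properly equivalent to `f` with `(g.a, c) = 1`, `c = 2^k·(s·c₁)` with `s = (c, q)` and `c₁`
odd, and `(a, c) = 1`. Then
`G(a, c; f, 0) = ((a·g.a)/s) · [χ₈(−q)^k · 2^k · (2^k/s) · (((q/s)/c₁) · G(1; s·c₁) · s · G(1; c₁))]`,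
the bracket depending on `c, q` only. [cite: ConreyIwaniec2002, §3 (3.15), (3.17)] -/
theorem binQuadGaussSum_zero_zero_eq_phase_cusp {q : ℕ} (hqodd : Odd q)
    {f g : BinQF} (hdisc : f.disc = -(q : ℤ)) (hfg : f.ProperEquiv g) {k s c₁ : ℕ} [NeZero s]
    [NeZero c₁] (hc₁ : Odd c₁) {c : ℕ} [NeZero c] (hc : c = 2 ^ k * (s * c₁)) (hs : s = c.gcd q)
    (hgA : g.a.gcd c = 1) {a : ℤ} (ha : a.gcd c = 1) :
    binQuadGaussSum c f a 0 0 =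
      jacobiSym (a * g.a) s *
        (((ZMod.χ₈ ((-(q : ℤ) : ℤ)) : ℤ) : ℂ) ^ k * 2 ^ k * jacobiSym (2 ^ k) s *
          ((jacobiSym ((q / s : ℕ) : ℤ) c₁ : ℂ) * quadGaussSum (s * c₁) 1 0 * s *
            quadGaussSum c₁ 1 0)) := by
  obtain ⟨hsodd, hD, hD₁⟩ := cusp_phase_data hqodd hc hs
  have hDodd : Odd f.disc := by
    rw [hdisc, odd_neg]; exact (Int.odd_coe_nat q).mpr hqodd
  have key := binQuadGaussSum_zero_zero_eq_phase_of_properEquiv hfg hDodd hsodd hc₁ hc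
    (hdisc.trans hD) hD₁ hgA ha
  rw [neg_neg] at key
  rw [key, hdisc]

/-- **`|E(c, q)| = c·√s`** for the bracket of `binQuadGaussSum_zero_zero_eq_phase_cusp` — the
normalisation `|η| = 1` of `η = −i·G(a,c;f,0)/(c√s)` (Conrey–Iwaniec (2.30)).
[cite: ConreyIwaniec2002, §2 (2.30), §3 (3.15), (3.17)] -/
theorem norm_cusp_phaseFactor {q : ℕ} (hqodd : Odd q) {k s c₁ : ℕ} [NeZero s] [NeZero c₁]
    (hc₁ : Odd c₁) {c : ℕ} [NeZero c] (hc : c = 2 ^ k * (s * c₁)) (hs : s = c.gcd q) :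
    ‖((ZMod.χ₈ ((-(q : ℤ) : ℤ)) : ℤ) : ℂ) ^ k * 2 ^ k * jacobiSym (2 ^ k) s *
        ((jacobiSym ((q / s : ℕ) : ℤ) c₁ : ℂ) * quadGaussSum (s * c₁) 1 0 * s *
          quadGaussSum c₁ 1 0)‖ = c * Real.sqrt s := by
  obtain ⟨hsodd, -, hD₁⟩ := cusp_phase_data hqodd hc hs
  have hqodd' : Odd (-(q : ℤ)) := by rw [odd_neg]; exact (Int.odd_coe_nat q).mpr hqodd
  have key := norm_phaseFactor hqodd' k hsodd hc₁ hD₁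
  rw [neg_neg] at key
  rw [key, hc]

end Literature.NumberTheory.ModularForms

end
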